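import Mathlib
import Literature.Computability.AlgebraicComplexity.HessianRank
import Summits.ValiantsHypothesis.ValiantsHypothesis.Theorems.GrenetZeonTwoDimCoefficientsGradedTopTrace
import Summits.ValiantsHypothesis.ValiantsHypothesis.Theorems.GrenetZeonTwoDimCoefficientsSlotAccountingRank

/-!
# Crux `GrenetZeon.TwoDimCoefficients` (stmt-ValiantsHypothesis-8062) / rung `DualUnipotentThreeHalves` (stmt-24318):
# the Hessian of a consecutive-graded top trace, read SLOT BY SLOT (Theorem T7, kernel plan step 4a)

Memo TWENTY-SECOND HAND §4.  ✓ `hess0_transl_trace_pow_mul_eq_cross_of_graded` gives `Hess_p tr(N^{n−1}·M) = Ψ + Ψᵀ` with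
`Ψ(s,t) = tr(K·N_s·K·W_t)`, `W_t = M'_t + N_t·K·M'(p)`.  Since `N` is graded, `Ψ = Θ·G` where `G` lists, for each graded position
`(b, a)` (`lvl b = lvl a + 1`), the entry `(K·W_t·K) b a`; grouping the graded positions by slot `ℓ = lvl a` and reshaping each
row block as the SLOT MAP `y ↦ (K·W_y·K)|_{(ℓ+1) × ℓ}` (`W_y = M'_y + N_y·K·M'(p)`, `N_y` graded, `M'_y` an `(n−1)`-drop matrix):

* ★ `rank_hess0_graded_le_two_mul_sum_slot` — `rank Hess_p tr(N^{n−1}·M) ≤ 2·Σ_{ℓ<H} B ℓ` for ANY per-slot bounds `B ℓ` on the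
  ranges of slot maps of that shape (`H` a strict bound on the levels).  The two-pivot slot lemma ✓ `finrank_range_slot_le`
  and the trivial bound `w_ℓ·w_{ℓ+1}` are such `B`; the pivot choice and accounting (step 4b/5) are not here.

Pure bookkeeping.  HONEST FRAMING: a brick; the stub `DualUnipotentBound`, the 24318 decl and `VP ≠ VNP` remain open.

References: folklore linear algebra.
-/

set_option linter.dupNamespace false
set_option autoImplicit false

noncomputable section

namespace Summit.ValiantsHypothesis.ValiantsHypothesis.Theorems.GrenetZeonTwoDimCoefficients.GradedHessianSlots

open Module Matrix MvPolynomial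
open Literature.Computability.AlgebraicComplexity
open Summit.ValiantsHypothesis.ValiantsHypothesis.Cruxes.TwoDimCoefficients.DimTwoCases (AffMat IsAffine)
open Summit.ValiantsHypothesis.ValiantsHypothesis.Theorems.GrenetZeonTwoDimCoefficients.GradedTopTrace
  (hess0_transl_trace_pow_mul_eq_cross_of_graded)
open Summit.ValiantsHypothesis.ValiantsHypothesis.Theorems.GrenetZeonTwoDimCoefficients.SlotAccounting
  (rank_le_sum_rank_rowBlocks)

variable {n m : ℕ} (lvl : Fin m → ℕ)

/-- Rank of a row block reshaped as a matrix-valued map: if `e : {rows of the block} ≃ a × b`, the rank of the block is the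
dimension of the range of `y ↦ (i, j) ↦ (block·y) (e⁻¹ (i, j))`. [folklore] -/
theorem rank_submatrix_eq_finrank_range {σ ρ : Type*} [Fintype σ] [Fintype ρ] (G : Matrix ρ σ ℂ)
    {a b : Type*} [Fintype a] [Fintype b] (e : ρ ≃ a × b)
    (C : (σ → ℂ) →ₗ[ℂ] Matrix a b ℂ) (hC : ∀ y, C y = Matrix.of fun i j => G.mulVec y (e.symm (i, j))) :
    G.rank = finrank ℂ ↥(LinearMap.range C) := by
  classical
  let Ψ : (ρ → ℂ) ≃ₗ[ℂ] Matrix a b ℂ :=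
    { toFun := fun v => Matrix.of fun i j => v (e.symm (i, j))
      invFun := fun X x => X (e x).1 (e x).2
      left_inv := fun v => by funext x; simp
      right_inv := fun X => by ext i j; simp
      map_add' := fun v w => by ext i j; simp
      map_smul' := fun c v => by ext i j; simp }
  have hCe : C = Ψ.toLinearMap ∘ₗ G.mulVecLin := by
    apply LinearMap.ext
    intro y
    rw [hC]
    rfl
  rw [Matrix.rank, hCe, LinearMap.range_comp, LinearEquiv.finrank_map_eq]

/-- ★ **The graded Hessian read slot by slot.**  For affine `N`, `M` with `N` consecutive-graded for `lvl` (`lvl < H`),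
`n − 1 < m`, a point `p`, and numbers `B ℓ` bounding the range of EVERY linear slot map of the shape
`y ↦ (K·(Mʸ + Nʸ·K·M'(p))·K)|_{(ℓ+1) × ℓ}` (`Nʸ` graded, `Mʸ` an `(n−1)`-drop matrix, `K = Σ_{j<m} N(p)^j`,
`M' = M^{(n−1)}`): `rank Hess_p tr(N^{n−1}·M) ≤ 2·Σ_{ℓ<H} B ℓ`. [folklore] -/
theorem rank_hess0_graded_le_two_mul_sum_slot (N M : AffMat n m) (hN : IsAffine N) (hM : IsAffine M)
    (hgr : ∀ a b, lvl b ≠ lvl a + 1 → N a b = 0) (hnm : n - 1 < m) (H : ℕ) (hH : ∀ i, lvl i < H)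
    (p : Fin n × Fin n → ℂ) (B : ℕ → ℕ)
    (hB : ∀ ℓ, ℓ < H →
      ∀ C : (Fin n × Fin n → ℂ) →ₗ[ℂ] Matrix {i : Fin m // lvl i = ℓ + 1} {j : Fin m // lvl j = ℓ} ℂ,
        (∀ y, ∃ Ny My : Matrix (Fin m) (Fin m) ℂ, (∀ a b, Ny a b ≠ 0 → lvl b = lvl a + 1) ∧
          (∀ d v, My d v ≠ 0 → lvl d = lvl v + (n - 1)) ∧
          C y = ((∑ j ∈ Finset.range m, N.map (eval p) ^ j) *
              (My + Ny * (∑ j ∈ Finset.range m, N.map (eval p) ^ j) *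
                ((Matrix.of (fun i j => if lvl i = lvl j + (n - 1) then M i j else 0) : AffMat n m).map (eval p))) *
              (∑ j ∈ Finset.range m, N.map (eval p) ^ j)).submatrix Subtype.val Subtype.val) →
        finrank ℂ ↥(LinearMap.range C) ≤ B ℓ) :
    (hess0 (transl p ((N ^ (n - 1) * M).trace))).rank ≤ 2 * ∑ ℓ ∈ Finset.range H, B ℓ := by
  classical
  -- names
  set K : Matrix (Fin m) (Fin m) ℂ := ∑ j ∈ Finset.range m, N.map (eval p) ^ j with hK
  set M' : AffMat n m := Matrix.of (fun i j => if lvl i = lvl j + (n - 1) then M i j else 0) with hM'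
  set Ns : (Fin n × Fin n) → Matrix (Fin m) (Fin m) ℂ := fun s => N.map (coeff (Finsupp.single s 1)) with hNs
  set Ms : (Fin n × Fin n) → Matrix (Fin m) (Fin m) ℂ := fun s => M'.map (coeff (Finsupp.single s 1)) with hMs
  set M0 : Matrix (Fin m) (Fin m) ℂ := M'.map (eval p) with hM0
  set W : (Fin n × Fin n) → Matrix (Fin m) (Fin m) ℂ := fun t => Ms t + Ns t * (K * M0) with hW
  set Ψ : Matrix (Fin n × Fin n) (Fin n × Fin n) ℂ := Matrix.of fun s t => (K * Ns s * K * W t).trace with hΨ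
  -- (1) the exact Hessian
  have hH0 : hess0 (transl p ((N ^ (n - 1) * M).trace)) = Ψ + Ψᵀ := by
    rw [hess0_transl_trace_pow_mul_eq_cross_of_graded lvl N M hN hM hgr hnm p]
  -- supports
  have hNs_gr : ∀ s a b, lvl b ≠ lvl a + 1 → Ns s a b = 0 := by
    intro s a b hab
    simp only [hNs, Matrix.map_apply, hgr a b hab, coeff_zero]
  have hMs_dr : ∀ s d v, lvl d ≠ lvl v + (n - 1) → Ms s d v = 0 := by
    intro s d v hdv
    simp only [hMs, hM', Matrix.map_apply, Matrix.of_apply, if_neg hdv, coeff_zero]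
  -- (2) `Ψ = Θ·G` with `G` supported on the graded positions
  set Θ : Matrix (Fin n × Fin n) (Fin m × Fin m) ℂ := Matrix.of fun s e => Ns s e.2 e.1 with hΘ
  set G : Matrix (Fin m × Fin m) (Fin n × Fin n) ℂ :=
    Matrix.of fun e t => if lvl e.1 = lvl e.2 + 1 then (K * W t * K) e.1 e.2 else 0 with hG
  have hΨΘG : Ψ = Θ * G := by
    ext s t
    rw [hΨ, Matrix.of_apply, Matrix.mul_apply, Fintype.sum_prod_type]
    have hcyc : (K * Ns s * K * W t).trace = (Ns s * (K * W t * K)).trace := by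
      rw [show K * Ns s * K * W t = K * (Ns s * K * W t) by simp only [Matrix.mul_assoc], Matrix.trace_mul_comm]
      simp only [Matrix.mul_assoc]
    rw [hcyc, Matrix.trace]
    simp only [Matrix.diag]
    simp_rw [Matrix.mul_apply (M := Ns s) (N := K * W t * K)]
    rw [Finset.sum_comm]
    refine Finset.sum_congr rfl fun b _ => Finset.sum_congr rfl fun a _ => ?_
    simp only [hΘ, hG, Matrix.of_apply]
    by_cases hab : lvl b = lvl a + 1
    · rw [if_pos hab]
    · rw [if_neg hab, hNs_gr s a b hab, zero_mul, mul_zero]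
  -- (3) rank bookkeeping: `rank (Ψ + Ψᵀ) ≤ 2·rank G`
  have hrank1 : (hess0 (transl p ((N ^ (n - 1) * M).trace))).rank ≤ 2 * G.rank := by
    rw [hH0]
    refine (rank_add_le _ _).trans ?_
    rw [Matrix.rank_transpose, hΨΘG]
    have := Matrix.rank_mul_le_right Θ G
    omega
  -- (4) row blocks of `G` by slot (garbage class `H` for the non-graded positions, which are zero rows)
  let grp : Fin m × Fin m → Fin (H + 1) := fun e =>
    ⟨if lvl e.1 = lvl e.2 + 1 then lvl e.2 else H, by split_ifs <;> [exact (hH e.2).trans (Nat.lt_succ_self H); exact Nat.lt_succ_self H]⟩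
  have hgrp_val : ∀ e, (grp e : ℕ) = if lvl e.1 = lvl e.2 + 1 then lvl e.2 else H := fun e => rfl
  have hrank2 := rank_le_sum_rank_rowBlocks G grp
  -- the garbage block vanishes
  have hlast : (G.submatrix (Subtype.val : {e // grp e = Fin.last H} → Fin m × Fin m) id).rank = 0 := by
    have : G.submatrix (Subtype.val : {e // grp e = Fin.last H} → Fin m × Fin m) id = 0 := by
      ext e t
      have he := congrArg Fin.val e.2
      rw [hgrp_val, Fin.val_last] at he
      have hne : ¬ lvl e.1.1 = lvl e.1.2 + 1 := by
        intro h
        rw [if_pos h] at he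
        exact absurd (hH e.1.2) (by omega)
      simp [hG, hne]
    rw [this, Matrix.rank_zero]
  -- each slot block is a slot map
  have hslot : ∀ ℓ : Fin H,
      (G.submatrix (Subtype.val : {e // grp e = Fin.castSucc ℓ} → Fin m × Fin m) id).rank ≤ B ℓ := by
    intro ℓ
    -- membership in the class
    have hmem : ∀ e : Fin m × Fin m, grp e = Fin.castSucc ℓ ↔ (lvl e.1 = lvl e.2 + 1 ∧ lvl e.2 = ℓ) := by
      intro e
      rw [Fin.ext_iff, hgrp_val, Fin.val_castSucc]
      constructor
      · intro h
        by_cases hc : lvl e.1 = lvl e.2 + 1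
        · rw [if_pos hc] at h; exact ⟨hc, h⟩
        · rw [if_neg hc] at h; exact absurd ℓ.2 (by omega)
      · rintro ⟨hc, h⟩
        rw [if_pos hc, h]
    -- the reshaping equivalence
    let eqv : {e : Fin m × Fin m // grp e = Fin.castSucc ℓ} ≃
        {i : Fin m // lvl i = (ℓ : ℕ) + 1} × {j : Fin m // lvl j = (ℓ : ℕ)} :=
      { toFun := fun e => (⟨e.1.1, by have h := (hmem e.1).mp e.2; omega⟩, ⟨e.1.2, ((hmem e.1).mp e.2).2⟩)
        invFun := fun ij => ⟨(ij.1.1, ij.2.1), (hmem _).mpr ⟨by rw [ij.1.2, ij.2.2], ij.2.2⟩⟩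
        left_inv := fun e => by ext <;> rfl
        right_inv := fun ij => by ext <;> rfl }
    -- the slot map
    let C : (Fin n × Fin n → ℂ) →ₗ[ℂ] Matrix {i : Fin m // lvl i = (ℓ : ℕ) + 1} {j : Fin m // lvl j = (ℓ : ℕ)} ℂ :=
      { toFun := fun y => Matrix.of fun i j =>
          (G.submatrix (Subtype.val : {e // grp e = Fin.castSucc ℓ} → Fin m × Fin m) id).mulVec y (eqv.symm (i, j))
        map_add' := fun y z => by ext i j; simp [Matrix.mulVec_add]
        map_smul' := fun c y => by ext i j; simp [Matrix.mulVec_smul] }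
    rw [rank_submatrix_eq_finrank_range _ eqv C (fun y => rfl)]
    refine hB ℓ ℓ.2 C fun y => ?_
    refine ⟨∑ t, y t • Ns t, ∑ t, y t • Ms t, ?_, ?_, ?_⟩
    · intro a b hab
      by_contra hc
      apply hab
      rw [Matrix.sum_apply]
      refine Finset.sum_eq_zero fun t _ => ?_
      rw [Matrix.smul_apply, hNs_gr t a b hc, smul_zero]
    · intro d v hdv
      by_contra hc
      apply hdv
      rw [Matrix.sum_apply]
      refine Finset.sum_eq_zero fun t _ => ?_
      rw [Matrix.smul_apply, hMs_dr t d v hc, smul_zero]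
    · -- `C y = (K·W_y·K)` block, `W_y = Σ_t y_t W_t = M'_y + N_y·K·M⁰`
      ext i j
      have hij : lvl (i : Fin m) = lvl (j : Fin m) + 1 := by rw [i.2, j.2]
      have hW_sum : ∑ t, y t • Ms t + (∑ t, y t • Ns t) * K * M0 = ∑ t, y t • W t := by
        rw [Finset.sum_mul, Finset.sum_mul, ← Finset.sum_add_distrib]
        refine Finset.sum_congr rfl fun t _ => ?_
        rw [hW, smul_add, Matrix.smul_mul, Matrix.smul_mul, Matrix.mul_assoc]
      rw [hW_sum, Matrix.submatrix_apply]
      have hdist : ∀ X : Matrix (Fin m) (Fin m) ℂ, X * (∑ t, y t • W t) * X = ∑ t, y t • (X * W t * X) := by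
        intro X
        rw [Finset.mul_sum, Finset.sum_mul]
        refine Finset.sum_congr rfl fun t _ => ?_
        rw [Matrix.mul_smul, Matrix.smul_mul]
      rw [hdist, Matrix.sum_apply]
      change ∑ t, (G.submatrix Subtype.val id) (eqv.symm (i, j)) t * y t = _
      refine Finset.sum_congr rfl fun t _ => ?_
      have he : ((eqv.symm (i, j) : {e // grp e = Fin.castSucc ℓ}) : Fin m × Fin m) = ((i : Fin m), (j : Fin m)) := rfl
      rw [Matrix.submatrix_apply, he, hG, Matrix.of_apply]
      simp only [id, hij, if_true]
      rw [Matrix.smul_apply, smul_eq_mul, mul_comm]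
  -- (5) sum up
  calc (hess0 (transl p ((N ^ (n - 1) * M).trace))).rank ≤ 2 * G.rank := hrank1
    _ ≤ 2 * ∑ c : Fin (H + 1), (G.submatrix (Subtype.val : {e // grp e = c} → Fin m × Fin m) id).rank :=
        Nat.mul_le_mul_left 2 hrank2
    _ = 2 * ∑ ℓ : Fin H, (G.submatrix (Subtype.val : {e // grp e = Fin.castSucc ℓ} → Fin m × Fin m) id).rank := by
        rw [Fin.sum_univ_castSucc, hlast, add_zero]
    _ ≤ 2 * ∑ ℓ : Fin H, B ℓ := Nat.mul_le_mul_left 2 (Finset.sum_le_sum fun ℓ _ => hslot ℓ)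
    _ = 2 * ∑ ℓ ∈ Finset.range H, B ℓ := by rw [Fin.sum_univ_eq_sum_range]

end Summit.ValiantsHypothesis.ValiantsHypothesis.Theorems.GrenetZeonTwoDimCoefficients.GradedHessianSlots

end
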